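import Summits.QuantumFields.BalabanUV.T4Continuum.Spine.NE3.LandauProjectionB8
import HarnessLib

/-!
# NE7BlockLandauCorrectionExists — THE EXISTENCE HALF OF (T2): on every periodic direction `Y` there is a block-mean-zero gauge `λ ∈ avgKernelGauges` (`N(Q′(W))`)
# such that `Y + gaugeDir W λ` is in BAŁABAN's BLOCK-LANDAU GAUGE — `hsR`-orthogonal over the period box to `gaugeDir W ν` for every `ν ∈ avgKernelGauges` (covariant
# divergence blockwise-constant; [B9] (3.25)'s `R(U)`-gauge TYPE) — by the Riesz vector of the Gram form of `gaugeDir W` on `N(Q′(W))`, positive definite because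
# `gaugeDir W λ = 0 ∧ bmeanIterW λ = 0 ⟹ λ = 0` in the class (file 102 of the curved (APE), F172)

Cell `pub-balaban`, rung (B)+1 sub-cell t4, lineage `b2b-balaban-t4-ne7-p1` (CRUX PROVER NE7 #1 = OWNER of row NE7), generation 83; memo
`t4/b2b-balaban-t4-ne7-p1-g83/BALABAN-GAUGE-ROAD.md` §5.  A TWIN of row NE3's `Spine/NE3/LandauProjectionB8.exists_landauB8_correction` (the same Gram∕Riesz argument for
[B8]'s (1.38)-Landau condition, whose test directions are `gaugeDir W (covLapSite W ν)`) with the PLAIN test directions `gaugeDir W ν`; nondegeneracy by row NE3's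
`eq_zero_of_covLapSite_eq_zero` (`covLapSite = covDiv ∘ gaugeDir`, `covDiv_gaugeDir_eq_covLapSite`).
WHY.  F170∕F171 display (T2): on Bałaban's straight slice, a `λ_b ∈ avgKernelGauges` moving the field into the `Gauge` side condition, with a sup size.  For the
instantiation `Gauge :=` Bałaban's block-Landau gauge the EXISTENCE is this file; the SIZE (`‖λ_b‖_∞ ≤ C_b‖covDiv_W X′‖_∞`, `C_b ≍ M²`, volume-free) is the remaining
scalar row (memo §5; (H0_W)'s `R_*` does not absorb the blockwise-constant multiplier — a block-mean-zero covariant Poisson row with the multiplier built in is what is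
needed).  §2 records the first-order condition the size proof starts from: testing against `ν = λ` gives `Σ‖D_Wλ‖² = −Σ hsR (Y)(D_Wλ)`.
WHAT ([folklore]; 0 def, 0 sorry).  §1 **`exists_blockLandau_correction`**; §2 `sum_nhsNormSq_gaugeDir_eq_neg_of_blockLandau` (the energy identity at `ν = λ`).
HONEST FRAMING (page 1): finite-dimensional linear algebra at a fixed background of the class; NO estimate; nothing of Bałaban's asserted; (APE) on curved data NOT proved;
NOT ONE-STEP, NOT NE7; spine 0∕9; finite T⁴ rung (B)+1 — NOT infinite volume, NOT mass gap, NOT `BetaPertH`, NOT Clay.  Continuum YM on T⁴ ⇐ BetaPertH ∧ nine spine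
estimates (0/9 proved); BetaPertH ⇐ (D1) ∧ (D4) ∧ CAP+tail; G-an2-4 gates asym, D1 and NE2/3/4.
-/

set_option autoImplicit false

open scoped BigOperators Matrix Matrix.Norms.L2Operator
open NormedSpace Finset

namespace Summit.QuantumFields.BalabanUV.T4Continuum.NE7BlockLandauCorrectionExists

open Literature.MathematicalPhysics.QuantumFieldTheory.Balaban1983to89
open B7Prop1Explicit B7Prop2Explicit MatrixNorms
open T4AveragingDeficitWall (Ad IsUnitaryCfg IsSkewDir SmallField)
open T4AveragingDeficitWallBoundary (IsPeriodicCfg periodBox mem_periodBox)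
open AveragingDeficitPeriodicCounting (IsPeriodicDir)
open AveragingDeficitMultiLevelPrep (LevelSmall)
open BlockAveragePushDirGauge (gaugeDir isPeriodicDir_gaugeDir)
open NE3CovariantCalculus (hsR hsR_self hsR_add_left hsR_add_right)
open NE3CovariantWeitzenbock (covDiv)
open NE3LandauOrbit (eq_zero_of_nhsNormSq_eq_zero)
open NE3FrameFreeDecompositionPrep (hsR_smul_left hsR_smul_right)
open NE3CurvedCornerGaugeSpace (gaugeDir_add_pi gaugeDir_smul_pi)
open NE3FrameFreeSliceW (bmeanIterW_add bmeanIterW_smul bmeanIterW_zero')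
open PeriodicChoice (apply_wrap_eq wrap_mem_periodBox)
open NE3.PairLandauB8 (avgKernelGauges mem_avgKernelGauges_iff covLapSite)
open NE3.LandauProjectionB8 (eq_zero_of_covLapSite_eq_zero covDiv_gaugeDir_eq_covLapSite)

noncomputable section

variable {d : ℕ} {n : Type*} [Fintype n] [DecidableEq n]

/-! ## §1 Existence of the block-Landau correction -/

/-- **THE BLOCK-LANDAU CORRECTION EXISTS** (multi-level small-field class at `W`, level `j+1`, period `N·L^{j+1}`): for every direction `Y` there is
`λ ∈ N(Q′(W))` (`avgKernelGauges`: skew, periodic, `bmeanIterW λ = 0`) with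
`Σ_{x ∈ periodBox} Σ_κ hsR (Y x κ + gaugeDir W λ x κ) (gaugeDir W ν x κ) = 0` for all `ν ∈ N(Q′(W))` — the minimiser of `‖Y + gaugeDir W λ‖²` over the block-mean-zero
gauge orbit; Riesz vector of the Gram form `Σ hsR (D_Wλ)(D_Wν)`, nondegenerate by `eq_zero_of_covLapSite_eq_zero`. [folklore] -/
theorem exists_blockLandau_correction [Nonempty n] {L N : ℕ} (hL : 1 ≤ L) (hN : 1 ≤ N) (j : ℕ) {W : Site d → Fin d → (Matrix n n ℂ)ˣ} {x : ℝ}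
    (hWu : IsUnitaryCfg W) (hWP : IsPeriodicCfg W ((N * L ^ (j + 1) : ℕ) : ℤ)) (hx : 0 ≤ x) (hs : LevelSmall d L j x) (hWx : SmallField W x)
    (Y : Site d → Fin d → Matrix n n ℂ) :
    ∃ lam ∈ avgKernelGauges (d := d) (n := n) L N (j + 1) W,
      ∀ nu ∈ avgKernelGauges (d := d) (n := n) L N (j + 1) W,
        ∑ y ∈ periodBox (d := d) (N * L ^ (j + 1)), ∑ κ : Fin d, hsR (Y y κ + gaugeDir W lam y κ) (gaugeDir W nu y κ) = 0 := by
  haveI : NeZero N := ⟨by omega⟩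
  have hP : 1 ≤ N * L ^ (j + 1) := Nat.mul_pos (by omega) (Nat.pow_pos (by omega))
  -- `N(Q′(W))` as a real submodule
  let S : Submodule ℝ (Site d → Matrix n n ℂ) :=
    { carrier := avgKernelGauges (d := d) (n := n) L N (j + 1) W
      zero_mem' := ⟨fun _ => (skewAdjoint _).zero_mem, fun _ _ => rfl, bmeanIterW_zero' L (j + 1) W⟩
      add_mem' := by
        rintro mu nu ⟨hμs, hμP, hμ0⟩ ⟨hνs, hνP, hν0⟩
        refine ⟨fun y => (skewAdjoint _).add_mem (hμs y) (hνs y), fun y i => ?_, ?_⟩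
        · simp only [Pi.add_apply, hμP, hνP]
        · rw [bmeanIterW_add, hμ0, hν0, add_zero]
      smul_mem' := by
        rintro t mu ⟨hμs, hμP, hμ0⟩
        refine ⟨fun y => skewAdjoint.smul_mem t (hμs y), fun y i => ?_, ?_⟩
        · simp only [Pi.smul_apply, hμP]
        · rw [bmeanIterW_smul, hμ0, smul_zero] }
  have hSmem : ∀ {mu : Site d → Matrix n n ℂ}, mu ∈ S ↔ mu ∈ avgKernelGauges (d := d) (n := n) L N (j + 1) W := fun {mu} => Iff.rfl
  -- finite-dimensional: restriction to the period box is injective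
  haveI : FiniteDimensional ℝ S := by
    let res : S →ₗ[ℝ] (↥(periodBox (d := d) (N * L ^ (j + 1))) → Matrix n n ℂ) :=
      { toFun := fun ξ y => (ξ : Site d → Matrix n n ℂ) y.1
        map_add' := fun _ _ => rfl
        map_smul' := fun _ _ => rfl }
    refine FiniteDimensional.of_injective res fun ξ ζ h => ?_
    apply Subtype.ext
    funext y
    have hξ := apply_wrap_eq (mem_avgKernelGauges_iff.mp (hSmem.mp ξ.2)).2.1 y
    have hζ := apply_wrap_eq (mem_avgKernelGauges_iff.mp (hSmem.mp ζ.2)).2.1 y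
    rw [← hξ, ← hζ]
    exact congr_fun h ⟨_, wrap_mem_periodBox (N * L ^ (j + 1)) hP y⟩
  -- the Gram form of the plain gauge directions
  let G : LinearMap.BilinForm ℝ S :=
    LinearMap.mk₂ ℝ
      (fun lam nu => ∑ y ∈ periodBox (d := d) (N * L ^ (j + 1)), ∑ κ : Fin d,
        hsR (gaugeDir W (lam : Site d → Matrix n n ℂ) y κ) (gaugeDir W (nu : Site d → Matrix n n ℂ) y κ))
      (fun lam lam' nu => by
        simp only [Submodule.coe_add, gaugeDir_add_pi, hsR_add_left, Finset.sum_add_distrib])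
      (fun t lam nu => by
        simp only [Submodule.coe_smul, gaugeDir_smul_pi, hsR_smul_left, Finset.mul_sum, smul_eq_mul])
      (fun lam nu nu' => by
        simp only [Submodule.coe_add, gaugeDir_add_pi, hsR_add_right, Finset.sum_add_distrib])
      (fun t lam nu => by
        simp only [Submodule.coe_smul, gaugeDir_smul_pi, hsR_smul_right, Finset.mul_sum, smul_eq_mul])
  have hG : ∀ lam nu : S, G lam nu = ∑ y ∈ periodBox (d := d) (N * L ^ (j + 1)), ∑ κ : Fin d,
      hsR (gaugeDir W (lam : Site d → Matrix n n ℂ) y κ) (gaugeDir W (nu : Site d → Matrix n n ℂ) y κ) := fun _ _ => rfl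
  -- nondegeneracy: `G λ λ = Σ‖D_Wλ‖²`, and `D_Wλ = 0` with `bmeanIterW λ = 0` forces `λ = 0`
  have key : ∀ lam : S, G lam lam = 0 → lam = 0 := by
    intro lam h
    obtain ⟨hls, hlP, hl0⟩ := mem_avgKernelGauges_iff.mp (hSmem.mp lam.2)
    rw [hG] at h
    simp only [hsR_self] at h
    have hbox : ∀ y ∈ periodBox (d := d) (N * L ^ (j + 1)), ∀ κ : Fin d, gaugeDir W (lam : Site d → Matrix n n ℂ) y κ = 0 := by
      intro y hy κ
      have h1 := (Finset.sum_eq_zero_iff_of_nonneg fun y' _ =>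
        Finset.sum_nonneg fun κ' _ => nhsNormSq_nonneg (gaugeDir W (lam : Site d → Matrix n n ℂ) y' κ')).1 h y hy
      have h2 := (Finset.sum_eq_zero_iff_of_nonneg fun κ' _ =>
        nhsNormSq_nonneg (gaugeDir W (lam : Site d → Matrix n n ℂ) y κ')).1 h1 κ (Finset.mem_univ κ)
      exact eq_zero_of_nhsNormSq_eq_zero h2
    have hper := isPeriodicDir_gaugeDir hWP hlP
    have hall : ∀ (y : Site d) (κ : Fin d), gaugeDir W (lam : Site d → Matrix n n ℂ) y κ = 0 := by
      intro y κ
      have hw := apply_wrap_eq (g := fun y' => gaugeDir W (lam : Site d → Matrix n n ℂ) y' κ) (fun y' i => hper y' i κ) y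
      rw [← hw]
      exact hbox _ (wrap_mem_periodBox (N * L ^ (j + 1)) hP y) κ
    have hzero : gaugeDir W (lam : Site d → Matrix n n ℂ) = fun _ _ => 0 := funext fun y => funext fun κ => hall y κ
    have hlap : ∀ y ∈ periodBox (d := d) (N * L ^ (j + 1)), covLapSite W (lam : Site d → Matrix n n ℂ) y = 0 := by
      intro y _
      rw [← covDiv_gaugeDir_eq_covLapSite, hzero]
      simp [NE3CovariantWeitzenbock.covDiv, AveragingDeficitNearIdentity.Ad_zero]
    exact Subtype.ext (eq_zero_of_covLapSite_eq_zero hL hN j hWu hWP hx hs hWx (hSmem.mp lam.2) hlap)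
  have hGnd : G.Nondegenerate := ⟨fun lam hlam => key lam (hlam lam), fun lam hlam => key lam (hlam lam)⟩
  -- the functional and its Riesz vector
  let ℓ : Module.Dual ℝ S :=
    { toFun := fun nu => -∑ y ∈ periodBox (d := d) (N * L ^ (j + 1)), ∑ κ : Fin d,
        hsR (Y y κ) (gaugeDir W (nu : Site d → Matrix n n ℂ) y κ)
      map_add' := fun nu nu' => by
        simp only [Submodule.coe_add, gaugeDir_add_pi, hsR_add_right, Finset.sum_add_distrib, neg_add]
      map_smul' := fun t nu => by
        simp only [Submodule.coe_smul, gaugeDir_smul_pi, hsR_smul_right, Finset.mul_sum, RingHom.id_apply, smul_eq_mul, mul_neg] }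
  set lam := (G.toDual hGnd).symm ℓ with hlam_def
  refine ⟨lam, hSmem.mp lam.2, fun nu hnu => ?_⟩
  have h := LinearMap.BilinForm.apply_toDual_symm_apply (hB := hGnd) ℓ ⟨nu, hnu⟩
  rw [← hlam_def, hG] at h
  have hℓ : ℓ ⟨nu, hnu⟩ = -∑ y ∈ periodBox (d := d) (N * L ^ (j + 1)), ∑ κ : Fin d, hsR (Y y κ) (gaugeDir W nu y κ) := rfl
  rw [hℓ] at h
  simp only [hsR_add_left, Finset.sum_add_distrib]
  linarith

/-! ## §2 The energy identity the size proof starts from -/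

/-- **TESTING THE BLOCK-LANDAU CONDITION AGAINST THE CORRECTION ITSELF**: if `λ ∈ N(Q′(W))` and `Y + gaugeDir W λ` is block-Landau, then
`Σ nhsNormSq (gaugeDir W λ) = −Σ hsR (Y)(gaugeDir W λ)` over the period box — whence `‖D_Wλ‖₂ ≤ ‖Y‖₂` (projection), and, after summation by parts, the pairing with
`covDiv_W Y` that the sup-size proof of (T2) localises. [folklore] -/
theorem sum_nhsNormSq_gaugeDir_eq_neg_of_blockLandau {L N : ℕ} (j : ℕ) {W : Site d → Fin d → (Matrix n n ℂ)ˣ}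
    (Y : Site d → Fin d → Matrix n n ℂ) {lam : Site d → Matrix n n ℂ} (hlam : lam ∈ avgKernelGauges (d := d) (n := n) L N (j + 1) W)
    (hL8 : ∀ nu ∈ avgKernelGauges (d := d) (n := n) L N (j + 1) W,
      ∑ y ∈ periodBox (d := d) (N * L ^ (j + 1)), ∑ κ : Fin d, hsR (Y y κ + gaugeDir W lam y κ) (gaugeDir W nu y κ) = 0) :
    ∑ y ∈ periodBox (d := d) (N * L ^ (j + 1)), ∑ κ : Fin d, nhsNormSq (gaugeDir W lam y κ)
      = -∑ y ∈ periodBox (d := d) (N * L ^ (j + 1)), ∑ κ : Fin d, hsR (Y y κ) (gaugeDir W lam y κ) := by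
  have h := hL8 lam hlam
  simp only [hsR_add_left, Finset.sum_add_distrib, hsR_self] at h
  linarith

end

end Summit.QuantumFields.BalabanUV.T4Continuum.NE7BlockLandauCorrectionExists
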